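import Literature.MathematicalPhysics.QuantumManyBody.LiebSimpleEquationYukawa
import Mathlib.Analysis.LConvolution
import HarnessLib

/-!
# Lieb's simple equation (Carlen–Jauslin–Lieb): the positive operators `G_c = Y_c ∗`

Topic: `Literature/MathematicalPhysics/QuantumManyBody`. Second layer of the proof of CJL-I
Theorem 1 (`CarlenJauslinLieb2020_thm1`; Carlen–Jauslin–Lieb, Pure Appl. Anal. 2 (2020),
arXiv:1912.04987, §2). CJL solve the simple equation by MONOTONE iteration (§2, Lemmas 4–6), so
the natural setting for the operators `G_c = (−Δ + c)⁻¹ = Y_c ∗` (CJL-I (1.7)–(1.9)) is Mathlib's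
lower-integral convolution `f ⋆ₗ g` of `[0, ∞]`-valued functions, where monotone convergence is
free. This file provides:

* a small monotone API for `⋆ₗ` (monotonicity, additivity and homogeneity in the second
  argument, monotone convergence, Tonelli `∫ f ⋆ₗ g = ∫f ∫g`, a.e.-congruence);
* for `G_c f := (ofReal ∘ Y_c) ⋆ₗ f`: **the resolvent identity `G_a = G_b + (b − a) G_a G_b`**
  (`yukawa_lconv_resolvent`, from the kernel identity of `LiebSimpleEquationYukawa.lean`), the
  mass bounds `G_c f ≤ (sup f)/c`, `∫ G_c f = c⁻¹∫f`, and the Hölder bound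
  `G_c|g| ≤ ‖Y_c‖_q ‖g‖_p` (finite for `p > 3/2`, the hypothesis of CJL-I Theorem 1);
* the bridge to the tree's real convolution `conv (yukawa c) f` (`LiebSimpleEquation.lean`).

## References

* [CarlenJauslinLieb2020] E. A. Carlen, I. Jauslin, E. H. Lieb, *Analysis of a simple equation for
  the ground state energy of the Bose gas*, Pure Appl. Anal. 2 (2020) 659–684, arXiv:1912.04987:
  (1.7)–(1.11), (1.13)–(1.16), §2.
-/

noncomputable section

open MeasureTheory Filter Set Real
open scoped ENNReal NNReal Topology

namespace Literature.MathematicalPhysics.QuantumManyBody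

namespace LiebSimpleEquation

open BoseGas (Space)

/-! ## Lower-integral convolution: general monotone API

Mathlib's `MeasureTheory.lconvolution` (`f ⋆ₗ g`, `(f ⋆ₗ g) x = ∫⁻ y, f y * g (-y + x)`) is the
natural home for the positive operators `G_c = Y_c ∗` acting on `[0, ∞]`-valued functions: all
the limits in CJL-I §2 are monotone. -/

section LConv

variable {G : Type*} [MeasurableSpace G] [AddCommGroup G] {μ : Measure G}

/-- `⋆ₗ` is monotone in both arguments. [folklore] -/
theorem lconvolution_mono {f f' g g' : G → ℝ≥0∞} (hf : f ≤ f') (hg : g ≤ g') :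
    f ⋆ₗ[μ] g ≤ f' ⋆ₗ[μ] g' :=
  fun _ => lintegral_mono fun y => mul_le_mul' (hf y) (hg _)

/-- `⋆ₗ` only depends on the a.e. class of its first argument. [folklore] -/
theorem lconvolution_congr_ae_left {f f' : G → ℝ≥0∞} (h : f =ᵐ[μ] f') (g : G → ℝ≥0∞) :
    f ⋆ₗ[μ] g = f' ⋆ₗ[μ] g := by
  funext x
  exact lintegral_congr_ae (h.mono fun y hy => by simp only [hy])

variable [MeasurableAdd₂ G] [MeasurableNeg G]

/-- `f ⋆ₗ (g + h) = f ⋆ₗ g + f ⋆ₗ h` for measurable `f`, `g`. [folklore] -/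
theorem lconvolution_add_right {f g : G → ℝ≥0∞} (hf : Measurable f) (hg : Measurable g)
    (h : G → ℝ≥0∞) (x : G) :
    (f ⋆ₗ[μ] (g + h)) x = (f ⋆ₗ[μ] g) x + (f ⋆ₗ[μ] h) x := by
  simp only [lconvolution_def, Pi.add_apply, mul_add]
  exact lintegral_add_left (hf.mul (hg.comp (by fun_prop))) _

/-- `f ⋆ₗ (C • g) = C • (f ⋆ₗ g)`. [folklore] -/
theorem lconvolution_const_mul_right {f g : G → ℝ≥0∞} (hf : Measurable f) (hg : Measurable g)
    (C : ℝ≥0∞) (x : G) :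
    (f ⋆ₗ[μ] fun y => C * g y) x = C * (f ⋆ₗ[μ] g) x := by
  simp only [lconvolution_def]
  have hm : Measurable fun y => f y * g (-y + x) := by fun_prop
  rw [← lintegral_const_mul C hm]
  refine lintegral_congr fun y => ?_
  ring

/-- **Monotone convergence for `⋆ₗ`**: `f ⋆ₗ (⨆ₙ gₙ) = ⨆ₙ f ⋆ₗ gₙ` for a monotone sequence of
measurable `gₙ`. [folklore] -/
theorem lconvolution_iSup_right {f : G → ℝ≥0∞} (hf : Measurable f) {g : ℕ → G → ℝ≥0∞}
    (hg : ∀ n, Measurable (g n)) (hmono : Monotone g) (x : G) :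
    (f ⋆ₗ[μ] fun y => ⨆ n, g n y) x = ⨆ n, (f ⋆ₗ[μ] g n) x := by
  simp only [lconvolution_def, ENNReal.mul_iSup]
  refine lintegral_iSup (fun n => hf.mul ((hg n).comp (by fun_prop))) fun n m hnm y => ?_
  exact mul_le_mul' le_rfl (hmono hnm _)

omit [MeasurableAdd₂ G] [MeasurableNeg G] in
/-- `f ⋆ₗ g ≤ (∫ f) · sup g`. [folklore] -/
theorem lconvolution_le_lintegral_mul {f g : G → ℝ≥0∞} (hf : Measurable f) {C : ℝ≥0∞}
    (hC : ∀ y, g y ≤ C) (x : G) :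
    (f ⋆ₗ[μ] g) x ≤ (∫⁻ y, f y ∂μ) * C := by
  rw [lconvolution_def, ← lintegral_mul_const C hf]
  exact lintegral_mono fun y => mul_le_mul' le_rfl (hC _)

/-- **Tonelli for `⋆ₗ`**: `∫ (f ⋆ₗ g) = (∫ f)(∫ g)` for a left-invariant measure. [folklore] -/
theorem lintegral_lconvolution [μ.IsAddLeftInvariant] [SFinite μ] {f g : G → ℝ≥0∞}
    (hf : Measurable f) (hg : Measurable g) :
    ∫⁻ x, (f ⋆ₗ[μ] g) x ∂μ = (∫⁻ y, f y ∂μ) * ∫⁻ y, g y ∂μ := by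
  simp only [lconvolution_def]
  have hm : Measurable (Function.uncurry fun x y => f y * g (-y + x)) := by
    show Measurable fun p : G × G => f p.2 * g (-p.2 + p.1)
    fun_prop
  rw [lintegral_lintegral_swap hm.aemeasurable]
  have h1 : ∀ y, ∫⁻ x, f y * g (-y + x) ∂μ = f y * ∫⁻ x, g x ∂μ := fun y => by
    have hgy : Measurable fun x => g (-y + x) := by fun_prop
    rw [lintegral_const_mul _ hgy, lintegral_add_left_eq_self]
  simp only [h1]
  rw [lintegral_mul_const _ hf]

end LConv

/-! ## The positive operators `G_c = Y_c ∗` on `[0, ∞]`-valued functions -/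

/-- `∫ Y_c = 1/c` in `ℝ≥0∞` form (`c > 0`). [cite: CarlenJauslinLieb2020, (1.8)–(1.9)] -/
theorem lintegral_ofReal_yukawa {c : ℝ} (hc : 0 < c) :
    ∫⁻ t, ENNReal.ofReal (yukawa c t) = ENNReal.ofReal (1 / c) := by
  rw [← ofReal_integral_eq_lintegral_ofReal (integrable_yukawa hc)
    (ae_of_all _ (yukawa_nonneg c)), integral_yukawa hc]

/-- `ofReal ∘ Y_c` is measurable. [folklore] -/
@[fun_prop]
theorem measurable_ofReal_yukawa (c : ℝ) : Measurable (ENNReal.ofReal ∘ yukawa c) :=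
  ENNReal.measurable_ofReal.comp (show Measurable (yukawa c) by unfold yukawa; fun_prop)

/-- **The resolvent identity `G_a = G_b + (b − a) G_a G_b`** (CJL-I (1.14) for `𝒱` a constant;
the first resolvent formula for `−Δ`) for the positive operators `G_c f = Y_c ⋆ₗ f` on measurable
`[0, ∞]`-valued `f`, pointwise at every `x`, `0 < a < b`. [cite: CarlenJauslinLieb2020, (1.13)–(1.15)] -/
theorem yukawa_lconv_resolvent {a b : ℝ} (ha : 0 < a) (hab : a < b) {f : Space → ℝ≥0∞}
    (hf : Measurable f) (x : Space) :
    ((ENNReal.ofReal ∘ yukawa a) ⋆ₗ f) x = ((ENNReal.ofReal ∘ yukawa b) ⋆ₗ f) x +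
      ENNReal.ofReal (b - a) *
        ((ENNReal.ofReal ∘ yukawa a) ⋆ₗ ((ENNReal.ofReal ∘ yukawa b) ⋆ₗ f)) x := by
  rw [lconvolution_assoc (measurable_ofReal_yukawa a) (measurable_ofReal_yukawa b) hf]
  have hker : ((ENNReal.ofReal ∘ yukawa a) ⋆ₗ (ENNReal.ofReal ∘ yukawa b)) =ᵐ[volume]
      fun w => ENNReal.ofReal ((yukawa a w - yukawa b w) / (b - a)) := by
    have h0 : ({0}ᶜ : Set Space) ∈ ae (volume : Measure Space) := by
      rw [compl_mem_ae_iff, measure_singleton]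
    filter_upwards [h0] with w hw
    rw [lconvolution_def]
    simp only [Function.comp_apply, neg_add_eq_sub]
    exact lintegral_yukawa_mul_yukawa ha hab hw
  rw [lconvolution_congr_ae_left hker]
  simp only [lconvolution_def, Function.comp_apply]
  have hYa : Measurable (yukawa a) := by unfold yukawa; fun_prop
  have hYb : Measurable (yukawa b) := by unfold yukawa; fun_prop
  have hm1 : Measurable fun y => ENNReal.ofReal ((yukawa a y - yukawa b y) / (b - a)) * f (-y + x) := by
    fun_prop
  have hm2 : Measurable fun y => ENNReal.ofReal (yukawa b y) * f (-y + x) := by fun_prop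
  rw [← lintegral_const_mul _ hm1, ← lintegral_add_left hm2]
  refine lintegral_congr fun y => ?_
  rw [← mul_assoc, ← add_mul, ← ENNReal.ofReal_mul (by linarith),
    mul_div_cancel₀ _ (sub_ne_zero.2 hab.ne'),
    ← ENNReal.ofReal_add (yukawa_nonneg _ _) (sub_nonneg.2 (yukawa_antitone hab.le y)),
    add_sub_cancel]

/-- `G_c f ≤ (sup f)/c`: `(Y_c ⋆ₗ f)(x) ≤ c⁻¹ · C` if `f ≤ C`. [cite: CarlenJauslinLieb2020, (1.8)] -/
theorem yukawa_lconv_le {c : ℝ} (hc : 0 < c) {f : Space → ℝ≥0∞} {C : ℝ≥0∞} (hC : ∀ y, f y ≤ C)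
    (x : Space) : ((ENNReal.ofReal ∘ yukawa c) ⋆ₗ f) x ≤ ENNReal.ofReal (1 / c) * C := by
  rw [← lintegral_ofReal_yukawa hc]
  exact lconvolution_le_lintegral_mul (measurable_ofReal_yukawa c) hC x

/-- `∫ G_c f = c⁻¹ ∫ f`. [cite: CarlenJauslinLieb2020, (1.11)] -/
theorem lintegral_yukawa_lconv {c : ℝ} (hc : 0 < c) {f : Space → ℝ≥0∞} (hf : Measurable f) :
    ∫⁻ x, ((ENNReal.ofReal ∘ yukawa c) ⋆ₗ f) x = ENNReal.ofReal (1 / c) * ∫⁻ y, f y := by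
  rw [lintegral_lconvolution (measurable_ofReal_yukawa c) hf]
  simp only [Function.comp_apply, lintegral_ofReal_yukawa hc]

/-- **Hölder bound for `G_c`** (how `p > 3/2` enters CJL-I Theorem 1): for `g ∈ Lᵖ(ℝ³)` and the
conjugate exponent `q < 3` (i.e. `p > 3/2`), `(Y_c ⋆ₗ |g|)(x) ≤ ‖Y_c‖_q ‖g‖_p` at every `x`.
[cite: CarlenJauslinLieb2020, §1 (after (1.16))] -/
theorem yukawa_lconv_enorm_le (c : ℝ) {p q : ℝ≥0∞} [ENNReal.HolderConjugate p q]
    {g : Space → ℝ} (hg : AEStronglyMeasurable g volume) (x : Space) :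
    ((ENNReal.ofReal ∘ yukawa c) ⋆ₗ fun t => ‖g t‖ₑ) x ≤
      eLpNorm (yukawa c) q volume * eLpNorm g p volume := by
  rw [lconvolution_def]
  have h1 : ∀ y, (ENNReal.ofReal ∘ yukawa c) y * ‖g (-y + x)‖ₑ = ‖g (x - y) * yukawa c y‖ₑ :=
    fun y => by
      rw [enorm_mul, Function.comp_apply, ← Real.enorm_eq_ofReal (yukawa_nonneg c y),
        neg_add_eq_sub, mul_comm]
  simp only [h1, ← eLpNorm_one_eq_lintegral_enorm]
  have hmp := Measure.measurePreserving_sub_left (volume : Measure Space) x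
  have hgx : AEStronglyMeasurable (fun y => g (x - y)) volume := hg.comp_measurePreserving hmp
  calc eLpNorm (fun y => g (x - y) * yukawa c y) 1 volume
      ≤ (1 : ℝ≥0) * eLpNorm (fun y => g (x - y)) p volume * eLpNorm (yukawa c) q volume :=
        eLpNorm_le_eLpNorm_mul_eLpNorm_of_nnnorm hgx (show Measurable (yukawa c) by unfold yukawa; fun_prop).aestronglyMeasurable
          (· * ·) 1 (ae_of_all _ fun y => by rw [one_mul, nnnorm_mul])
    _ = eLpNorm (yukawa c) q volume * eLpNorm g p volume := by
        rw [ENNReal.coe_one, one_mul, mul_comm]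
        congr 1
        exact eLpNorm_comp_measurePreserving hg hmp

/-- In particular `G_c |g|` is bounded (finite) for `g ∈ Lᵖ`, `p > 3/2` (`q < 3`), `c > 0`.
[cite: CarlenJauslinLieb2020, §1 (after (1.16))] -/
theorem yukawa_lconv_enorm_lt_top {c : ℝ} (hc : 0 < c) {p q : ℝ≥0∞} [ENNReal.HolderConjugate p q]
    (hq1 : 1 ≤ q) (hq3 : q < 3) {g : Space → ℝ} (hg : MemLp g p) (x : Space) :
    ((ENNReal.ofReal ∘ yukawa c) ⋆ₗ fun t => ‖g t‖ₑ) x < ∞ :=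
  (yukawa_lconv_enorm_le c hg.1 x).trans_lt
    (ENNReal.mul_lt_top (memLp_yukawa hc hq1 hq3).2 hg.2)

/-- The operators `G_a`, `G_b` commute. [folklore] -/
theorem yukawa_lconv_comm (a b : ℝ) {f : Space → ℝ≥0∞} (hf : Measurable f) :
    (ENNReal.ofReal ∘ yukawa a) ⋆ₗ ((ENNReal.ofReal ∘ yukawa b) ⋆ₗ f) =
      (ENNReal.ofReal ∘ yukawa b) ⋆ₗ ((ENNReal.ofReal ∘ yukawa a) ⋆ₗ f) := by
  rw [lconvolution_assoc (measurable_ofReal_yukawa a) (measurable_ofReal_yukawa b) hf,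
    lconvolution_assoc (measurable_ofReal_yukawa b) (measurable_ofReal_yukawa a) hf]
  congr 1
  exact lconvolution_comm

/-- `G_{c'} f ≤ G_c f` for `c ≤ c'` (the kernels decrease with the mass). [folklore] -/
theorem yukawa_lconv_anti {c c' : ℝ} (h : c ≤ c') (f : Space → ℝ≥0∞) :
    (ENNReal.ofReal ∘ yukawa c') ⋆ₗ f ≤ (ENNReal.ofReal ∘ yukawa c) ⋆ₗ f :=
  lconvolution_mono (fun y => ENNReal.ofReal_le_ofReal (yukawa_antitone h y)) le_rfl

/-- `G_c` of a constant: `G_c C = C/c`. [cite: CarlenJauslinLieb2020, (1.8)] -/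
theorem yukawa_lconv_const {c : ℝ} (hc : 0 < c) (C : ℝ≥0∞) (x : Space) :
    ((ENNReal.ofReal ∘ yukawa c) ⋆ₗ fun _ => C) x = ENNReal.ofReal (1 / c) * C := by
  rw [lconvolution_def, lintegral_mul_const _ (measurable_ofReal_yukawa c)]
  simp only [Function.comp_apply, lintegral_ofReal_yukawa hc]

/-! ## Bridge to the real (Bochner) convolution of the tree -/

/-- For `f ≥ 0`, the tree's real convolution `conv (yukawa c) f` is the real part of the
`[0, ∞]`-valued one: `(Y_c ∗ f)(x) = ((ofReal ∘ Y_c) ⋆ₗ (ofReal ∘ f))(x).toReal` (both are `0`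
when the integral diverges). [folklore] -/
theorem conv_yukawa_eq_toReal_lconv (c : ℝ) {f : Space → ℝ} (hf0 : ∀ y, 0 ≤ f y)
    (hfm : AEStronglyMeasurable f volume) (x : Space) :
    conv (yukawa c) f x =
      (((ENNReal.ofReal ∘ yukawa c) ⋆ₗ fun y => ENNReal.ofReal (f y)) x).toReal := by
  have hmp := Measure.measurePreserving_sub_left (volume : Measure Space) x
  rw [conv_apply, integral_eq_lintegral_of_nonneg_ae
    (ae_of_all _ fun y => mul_nonneg (yukawa_nonneg c y) (hf0 _))
    ((show Measurable (yukawa c) by unfold yukawa; fun_prop).aestronglyMeasurable.mul (hfm.comp_measurePreserving hmp))]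
  congr 1
  rw [lconvolution_def]
  refine lintegral_congr fun y => ?_
  rw [Function.comp_apply, neg_add_eq_sub, ENNReal.ofReal_mul (yukawa_nonneg c y)]

/-- If the `[0, ∞]`-valued convolution is finite at `x`, the real convolution `Y_c ∗ f` exists
at `x` (the integrand is integrable). [folklore] -/
theorem convolutionExistsAt_yukawa (c : ℝ) {f : Space → ℝ} (hf0 : ∀ y, 0 ≤ f y)
    (hfm : AEStronglyMeasurable f volume) {x : Space}
    (hx : ((ENNReal.ofReal ∘ yukawa c) ⋆ₗ fun y => ENNReal.ofReal (f y)) x < ∞) :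
    ConvolutionExistsAt (yukawa c) f x (ContinuousLinearMap.mul ℝ ℝ) volume := by
  have hmp := Measure.measurePreserving_sub_left (volume : Measure Space) x
  refine ⟨(show Measurable (yukawa c) by unfold yukawa; fun_prop).aestronglyMeasurable.mul (hfm.comp_measurePreserving hmp), ?_⟩
  rw [hasFiniteIntegral_iff_enorm]
  convert hx using 1
  rw [lconvolution_def]
  refine lintegral_congr fun y => ?_
  rw [ContinuousLinearMap.mul_apply', enorm_mul, Function.comp_apply, neg_add_eq_sub,
    Real.enorm_eq_ofReal (yukawa_nonneg c y), Real.enorm_eq_ofReal (hf0 _)]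

end LiebSimpleEquation

end Literature.MathematicalPhysics.QuantumManyBody
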